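import Summits.HubbardSuperconductivity.HubbardSuperconductivity.Theorems.DWavePolarisedDiscordance.Negative.BondOrderDoublonBound
import Summits.HubbardSuperconductivity.HubbardSuperconductivity.Theorems.EnslavedA1gIdentity

/-!
# Crux `DWavePolarisedDiscordance` (K3′, stmt-HubbardSuperconductivity-15314, route `LiebTwin`), line
# `registered`, stub `stub_massFeedsBondSinglets` (= the bond-locality form K3″, the recommended restatement
# K3′ := K3″) — negative-side support: K3″ too is carried by the BOTTOM-OF-SPECTRUM clause

K3″ (`stub_massFeedsBondSinglets`, proved crux-hard by the lead: K3′ ⇒ K3″, p147389; K2 ∧ K3″ ∧ NoOnsite ⇒ summit,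
p153625): `∀ (U,δ) ∈ box ∃κ>0 ∀ε>0, ev. in even L, ∀ unit sector GS φ: κ·(F_s(φ̃) - F_s(φ)) - εL⁴ ≤ F_d(φ) + F_xs(φ)`.
It is WEAKER than K3′ (`-F_d(φ̃) ≤ 0 ≤ F_xs(φ)`), so `FalseWithoutMinimality` does not settle its eigenvector-only
form. This file does: `stub_massFeedsBondSinglets_false_without_minimality` — K3″ VERBATIM with
`IsGroundStateInSector` weakened to "nonzero sector eigenvector" is FALSE, by the same witness, the normalised
staggered `η`-tower `φ_L ∝ (η_π†)^n|0⟩`: its discordance mass is maximal, `F_s(φ̃) - F_s(φ) ≥ 2n(L² - n) ≍ L⁴`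
(`StaggeredTowerOrders`), while ALL its bond pair orders are `O(n) = O(L²)` — `F_g(φ) ≤ 2 C_g² n` for every bond
form factor (`re_expect_pairField_smul_etaPairingState_le`, from the doublon bound of `BondOrderDoublonBound`):
a doublon condensate (momentum `π` or `0`) has no bond-singlet coherence at all. So the locality bet of K3″
("the on-site coherence destroyed by the signs reappears on nearest-neighbour singlet bonds") is, like K3′,
a statement about GROUND states only: exact excited eigenstates violate it maximally, and any proof must be
variational (the tower costs energy `nU`).

Sources: C. N. Yang, PRL **63** (1989) 2144, eqs. (4)–(11); E. H. Lieb, PRL **62** (1989) 1201;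
D. J. Scalapino, Phys. Rep. **250** (1995) 329, §2. Elementary; no definition (the mutated stub is spelled inline).
-/

noncomputable section

-- the mandated namespace repeats `HubbardSuperconductivity` (single-problem summit, D-0017)
set_option linter.dupNamespace false

namespace Summit.HubbardSuperconductivity.HubbardSuperconductivity.Theorems.DWavePolarisedDiscordance.Negative

open Matrix Finset Literature.MathematicalPhysics.QuantumLattice Literature.Probability.LatticeModels
open Summit.HubbardSuperconductivity.HubbardSuperconductivity.Theorems.NoOnsiteODLRO.Negative
  (isInSector_etaPairingState)
open scoped ComplexOrder

section StubMain

variable {L : ℕ} [NeZero L]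

/-- **Bond pair order of the normalised tower is `O(n)`**: for `g 0 = 0`, `L ≥ 2` and `‖c (η_ε†)^n|0⟩‖ = 1`,
`Re⟨φ, Δ_gᴴΔ_g φ⟩ ≤ 2 C_g² n` (doublon bound with weights `w_S = c n! ε_S`, `Σ_S ‖w_S‖² = ‖φ‖² = 1`).
Yang, PRL 63 (1989) 2144; Scalapino, Phys. Rep. 250 (1995) 329, §2. [folklore] -/
theorem re_expect_pairField_smul_etaPairingState_le [Fact (1 < L)] {g : Site 2 → ℝ} (hg : g 0 = 0)
    (ε : FermionTorus 2 L → ℤˣ) (n : ℕ) {c : ℂ}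
    (hc : star (c • etaPairingState ε n) ⬝ᵥ (c • etaPairingState ε n) = 1) :
    (expect ((pairField g L)ᴴ * pairField g L) (c • etaPairingState ε n)).re ≤
      2 * (∑ e ∈ insert 0 unitSteps, ‖((g e / Real.sqrt 2 : ℝ) : ℂ)‖ * 2) ^ 2 * n := by
  have hsum : c • etaPairingState ε n = ∑ S ∈ powersetCard n (univ : Finset (FermionTorus 2 L)),
      (c * (n.factorial : ℂ) * ∏ x ∈ S, ((ε x : ℤ) : ℂ)) • Pi.single (pairSet S S) (1 : ℂ) := by
    rw [etaPairingState_eq_sum, smul_smul, Finset.smul_sum]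
    simp_rw [smul_smul]
  rw [hsum] at hc ⊢
  refine (re_expect_pairField_doublonSum_le hg _ _).trans ?_
  have hcard : ∀ S ∈ powersetCard n (univ : Finset (FermionTorus 2 L)),
      (S.card : ℝ) * ‖c * (n.factorial : ℂ) * ∏ x ∈ S, ((ε x : ℤ) : ℂ)‖ ^ 2 =
        (n : ℝ) * ‖c * (n.factorial : ℂ) * ∏ x ∈ S, ((ε x : ℤ) : ℂ)‖ ^ 2 := fun S hS => by
    rw [(mem_powersetCard.1 hS).2]
  have hnorm : ∑ S ∈ powersetCard n (univ : Finset (FermionTorus 2 L)),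
      ‖c * (n.factorial : ℂ) * ∏ x ∈ S, ((ε x : ℤ) : ℂ)‖ ^ 2 = 1 := by
    have h := congrArg Complex.re hc
    rw [star_doublonSum_dotProduct_doublonSum, Complex.re_sum, Complex.one_re] at h
    rw [← h]
    refine Finset.sum_congr rfl fun S _ => ?_
    rw [Complex.star_def, Complex.conj_mul', ← Complex.ofReal_pow, Complex.ofReal_re]
  rw [Finset.sum_congr rfl hcard, ← Finset.mul_sum, hnorm, mul_one]

/-- Quantitative floor bookkeeping: with `4 ≤ X`, `3X/8 - 1 ≤ n ≤ 3X/8`: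
`(11/32)X² - (5/4)X ≤ 2n(X - n) - X²/8`. [folklore] -/
theorem witness_arith₂ {X n : ℝ} (hX : 4 ≤ X) (h1 : 3 * X / 8 - 1 ≤ n) (h2 : n ≤ 3 * X / 8) :
    11 / 32 * X ^ 2 - 5 / 4 * X ≤ 2 * (n * (X - n)) - X ^ 2 / 8 := by
  nlinarith [mul_nonneg (sub_nonneg.2 h1) (sub_nonneg.2 h2), mul_nonneg (sub_nonneg.2 hX) (sub_nonneg.2 h2),
    mul_nonneg (sub_nonneg.2 hX) (sub_nonneg.2 h1)]

open scoped MatrixOrder Matrix.Norms.L2Operator in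
/-- **The bottom-of-spectrum clause of K3″ (`stub_massFeedsBondSinglets`) is load-bearing.** The negated
statement is the stub VERBATIM except that `IsGroundStateInSector H (2n) 0 φ` is replaced by
`φ ∈ szSector (2n) 0 ∧ φ ≠ 0 ∧ ∃ E, H φ = E • φ` (drop ONLY the minimality of the eigenvalue). FALSE at
`(U, δ) = (1, 1/4)`: for the normalised staggered `η`-tower at a large even side `L` (chosen from `κ`),
`κ·(F_s(φ̃) - F_s(φ)) - (κ/8)L⁴ ≥ κ(2n(L² - n) - L⁴/8) ≥ κ((11/32)L⁴ - (5/4)L²)` while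
`F_d(φ) + F_xs(φ) ≤ 2(C_d² + C_xs²) n ≤ (3/4)(C_d² + C_xs²) L²`. READING: bond locality of the sign defect, like
d-polarisation, holds (if at all) only for GROUND states; the η_π-tower is the extremal state a proof must
exclude by energy. Yang, PRL 63 (1989) 2144; Lieb, PRL 62 (1989) 1201; Scalapino, Phys. Rep. 250 (1995) 329. [folklore] -/
theorem stub_massFeedsBondSinglets_false_without_minimality :
    ¬ (∀ U ∈ Set.Ioc (0 : ℝ) 4, ∀ δ ∈ Set.Icc (1 / 10 : ℝ) (3 / 10), ∃ κ : ℝ, 0 < κ ∧ ∀ ε : ℝ, 0 < ε →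
        ∃ L₀ : ℕ, ∀ (L : ℕ) [NeZero L], L₀ ≤ L → Even L → ∀ φ : Fock (Orb (FermionTorus 2 L)),
          star φ ⬝ᵥ φ = 1 →
          (φ ∈ szSector (Λ := FermionTorus 2 L) (2 * ⌊(1 - δ) * (L : ℝ) ^ 2 / 2⌋₊) 0 ∧ φ ≠ 0 ∧
              ∃ E : ℝ, hubbardTorus 2 L 1 U *ᵥ φ = (E : ℂ) • φ) →
          κ * ((expect ((pairField sWave L)ᴴ * pairField sWave L)
                  (liebVec ⌊(1 - δ) * (L : ℝ) ^ 2 / 2⌋₊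
                    (CFC.abs (liebW ⌊(1 - δ) * (L : ℝ) ^ 2 / 2⌋₊ φ)))).re -
                (expect ((pairField sWave L)ᴴ * pairField sWave L) φ).re) - ε * (L : ℝ) ^ 4 ≤
            (expect ((pairField dWaveFormFactor L)ᴴ * pairField dWaveFormFactor L) φ).re +
              (expect ((pairField extendedSWave L)ᴴ * pairField extendedSWave L) φ).re) := by
  intro h
  obtain ⟨κ, hκ, h⟩ := h 1 ⟨one_pos, by norm_num⟩ (1 / 4) ⟨by norm_num, by norm_num⟩
  obtain ⟨L₀, h⟩ := h (κ / 8) (by positivity)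
  -- the bond constants and the side `L`
  set K : ℝ := (∑ e ∈ insert 0 unitSteps, ‖((dWaveFormFactor e / Real.sqrt 2 : ℝ) : ℂ)‖ * 2) ^ 2 +
    (∑ e ∈ insert 0 unitSteps, ‖((extendedSWave e / Real.sqrt 2 : ℝ) : ℂ)‖ * 2) ^ 2 with hKdef
  have hK0 : 0 ≤ K := by positivity
  obtain ⟨M, hM⟩ := exists_nat_ge (4 + 3 * K / κ)
  haveI hNZ : NeZero (2 * (L₀ + M + 1)) := ⟨by omega⟩
  haveI hF : Fact (1 < 2 * (L₀ + M + 1)) := ⟨by omega⟩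
  have hLe : Even (2 * (L₀ + M + 1)) := even_two_mul _
  have h := h (2 * (L₀ + M + 1)) (by omega) hLe
  set L : ℕ := 2 * (L₀ + M + 1) with hLdef
  set n : ℕ := ⌊(1 - (1 / 4 : ℝ)) * (L : ℝ) ^ 2 / 2⌋₊ with hndef
  set X : ℝ := (L : ℝ) ^ 2 with hX
  have hLM : (M : ℝ) ≤ (L : ℝ) := by exact_mod_cast (show M ≤ L by omega)
  have hL2 : (2 : ℝ) ≤ (L : ℝ) := by exact_mod_cast (show 2 ≤ L by omega)
  have hX4 : 4 ≤ X := by rw [hX]; nlinarith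
  have hXM : 4 + 3 * K / κ ≤ X := by
    refine hM.trans (hLM.trans ?_)
    rw [hX]; nlinarith
  have hn1 : 3 * X / 8 - 1 ≤ (n : ℝ) := by
    have hlt : (1 - (1 / 4 : ℝ)) * (L : ℝ) ^ 2 / 2 < (n : ℝ) + 1 := Nat.lt_floor_add_one _
    rw [hX]; linarith
  have hn2 : (n : ℝ) ≤ 3 * X / 8 := by
    have hle : (n : ℝ) ≤ (1 - (1 / 4 : ℝ)) * (L : ℝ) ^ 2 / 2 := Nat.floor_le (by positivity)
    rw [hX]; linarith
  have hnL : n ≤ L ^ 2 := by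
    have : (n : ℝ) ≤ ((L ^ 2 : ℕ) : ℝ) := by push_cast; rw [← hX]; linarith
    exact_mod_cast this
  have hn0 : n ≠ 0 := by
    intro h0
    rw [h0, Nat.cast_zero] at hn1
    linarith
  obtain ⟨k, hk⟩ := Nat.exists_eq_add_one_of_ne_zero hn0
  -- the witness
  set ψ : Fock (Orb (FermionTorus 2 L)) := etaPairingState (torusStagger (d := 2) (L := L)) n with hψ
  have hψ0 : ψ ≠ 0 := etaPairingState_ne_zero _ (by rwa [card_fermionTorus])
  obtain ⟨c, hc0, hc1⟩ := exists_smul_unit hψ0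
  have hsec : IsInSector n n (c • ψ) := (isInSector_etaPairingState _ n).smul c
  have hmem : c • ψ ∈ szSector (Λ := FermionTorus 2 L) (2 * n) 0 :=
    (mem_szSector_two_mul_zero_iff n _).2 hsec
  have hne : c • ψ ≠ 0 := smul_ne_zero hc0 hψ0
  have heig : hubbardTorus 2 L 1 1 *ᵥ (c • ψ) = (((n : ℝ) * 1 : ℝ) : ℂ) • (c • ψ) := by
    rw [mulVec_smul, hψ, hubbardTorus_mulVec_etaPairingState_holds hLe 1 1 n, smul_comm]
  have hbad := h (c • ψ) hc1 ⟨hmem, hne, _, heig⟩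
  -- the orders of the witness
  have hFt : (expect ((pairField sWave L)ᴴ * pairField sWave L)
      (liebVec n (CFC.abs (liebW n (c • ψ))))).re = 2 * ((n : ℝ) * (X - n + 1)) := by
    rw [hψ, re_expect_pairField_sWave_twin_smul_etaPairingState, hc1, Complex.one_re, mul_one]
  have hFp : (expect ((pairField sWave L)ᴴ * pairField sWave L) (c • ψ)).re ≤ 2 * (n : ℝ) := by
    have h' := re_expect_pairField_sWave_smul_staggeredTower_le (c := c) hLe k (hk ▸ hnL)
      (by rw [← hk]; exact hc1)
    rw [← hk] at h'
    exact_mod_cast h'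
  have hFd : (expect ((pairField dWaveFormFactor L)ᴴ * pairField dWaveFormFactor L) (c • ψ)).re ≤
      2 * (∑ e ∈ insert 0 unitSteps, ‖((dWaveFormFactor e / Real.sqrt 2 : ℝ) : ℂ)‖ * 2) ^ 2 * n :=
    re_expect_pairField_smul_etaPairingState_le dWaveFormFactor_zero _ n hc1
  have hFx : (expect ((pairField extendedSWave L)ᴴ * pairField extendedSWave L) (c • ψ)).re ≤
      2 * (∑ e ∈ insert 0 unitSteps, ‖((extendedSWave e / Real.sqrt 2 : ℝ) : ℂ)‖ * 2) ^ 2 * n :=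
    re_expect_pairField_smul_etaPairingState_le Summit.HubbardSuperconductivity.EnslavedA1g.extendedSWave_zero _ n hc1
  -- contradiction
  rw [hFt] at hbad
  have hL4 : (L : ℝ) ^ 4 = X ^ 2 := by rw [hX]; ring
  rw [hL4] at hbad
  have hsumK : (expect ((pairField dWaveFormFactor L)ᴴ * pairField dWaveFormFactor L) (c • ψ)).re +
      (expect ((pairField extendedSWave L)ᴴ * pairField extendedSWave L) (c • ψ)).re ≤ 2 * K * n := by
    rw [hKdef]; linarith
  have key := witness_arith₂ hX4 hn1 hn2
  have hκX : 4 * κ + 3 * K ≤ κ * X := by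
    have h1 := mul_le_mul_of_nonneg_left hXM hκ.le
    rwa [mul_add, mul_div_assoc', mul_div_cancel_left₀ _ hκ.ne', ← mul_comm] at h1
  have hXpos : 0 < X := by linarith
  nlinarith [hbad, hFp, hsumK, key, hκX, mul_pos hκ hXpos, mul_nonneg hK0 hXpos.le,
    mul_le_mul_of_nonneg_left hn2 hK0]

end StubMain

end Summit.HubbardSuperconductivity.HubbardSuperconductivity.Theorems.DWavePolarisedDiscordance.Negative

end
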